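import Mathlib
import HarnessLib

/-!
# BirchSwinnertonDyer / VerticalContact — crux `VerticalSelmerBound` (stmt-BirchSwinnertonDyer-18432),
# line `toric_control`, stub `stub_offBranchVacuous`

Registered stub (skeleton `Cruxes/VerticalSelmerBound/Lines/toric_control.lean`, lead reshape of the rev-1 typing
artefact): when the class number `h = h_K` is prime to `p - 1` (and `p ∤ 6h`, a conjunct of the crux data), the weak
weight clause of the crux, `2(p-1)p^N ∣ k-2 ∧ 2h ∣ k-2`, already implies the branch clause `2(p-1)p^N·h ∣ k-2`
(refuter rattack 05:21Z, slip R2: off-branch weights exist iff `gcd(h_K, p-1) > 1`). Pure arithmetic: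
`h` is prime to `p` (as `p ∤ 6h`), to `p - 1` (hypothesis) and hence to `2` (`p` is odd), so to `2(p-1)p^N`,
and coprime divisors multiply.
-/

set_option linter.dupNamespace false

namespace Summit.BirchSwinnertonDyer.BirchSwinnertonDyer.Theorems

/-- **Off the branch is empty when `gcd(h_K, p-1) = 1`.** For a prime `p` with `p ∤ 6h` and `h` coprime to
`p - 1`: `2(p-1)p^N ∣ k-2` and `2h ∣ k-2` imply `2(p-1)p^N·h ∣ k-2`. (So the crux's weak weight clause coincides
with the branch clause `2(p-1)p^N·h_K ∣ k-2` exactly when `gcd(h_K, p-1) = 1`; refuter rattack 05:21Z, R2.)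
[folklore] -/
theorem stub_offBranchVacuous :
    ∀ (p N k h : ℕ), p.Prime → ¬ p ∣ 6 * h → Nat.Coprime h (p - 1) → 2 * (p - 1) * p ^ N ∣ k - 2 →
      2 * h ∣ k - 2 → 2 * (p - 1) * p ^ N * h ∣ k - 2 := by
  intro p N k h hp h6 hcop h1 h2
  -- `h` is prime to `p`
  have hph : Nat.Coprime p h := by
    rw [Nat.Prime.coprime_iff_not_dvd hp]
    intro hd
    exact h6 (dvd_mul_of_dvd_right hd 6)
  -- `p` is odd, so `2 ∣ p - 1` and `h` is prime to `2`
  have hp2 : p ≠ 2 := by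
    rintro rfl
    exact h6 (dvd_mul_of_dvd_left (by norm_num) h)
  have h2dvd : 2 ∣ p - 1 := by
    rcases hp.eq_two_or_odd' with h | hodd
    · exact absurd h hp2
    · obtain ⟨m, hm⟩ := hodd
      exact ⟨m, by omega⟩
  have hc2 : Nat.Coprime h 2 := Nat.Coprime.coprime_dvd_right h2dvd hcop
  have hcpN : Nat.Coprime h (p ^ N) := Nat.Coprime.pow_right N hph.symm
  have hcall : Nat.Coprime (2 * (p - 1) * p ^ N) h :=
    (Nat.Coprime.mul_right (Nat.Coprime.mul_right hc2 hcop) hcpN).symm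
  have hh : h ∣ k - 2 := dvd_trans (dvd_mul_left h 2) h2
  exact Nat.Coprime.mul_dvd_of_dvd_of_dvd hcall h1 hh

end Summit.BirchSwinnertonDyer.BirchSwinnertonDyer.Theorems
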